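import Mathlib
import HarnessLib

/-!
# Crux K2 `PoloidalWindowRigidity` (stmt-NavierStokesRegularity-19708), line `z_shock` — rung R2 under NON-UNIFORM genuine nonlinearity:
# a bounded Lipschitz function with FINITE GENUINE-NONLINEARITY BUDGET converges, and its limit is a degenerate value

`--supports stmt-NavierStokesRegularity-19708 --as helper` (leafhand-ns-poloidalwindowdoor-3 g2, cell decomp-ns, 2026-08-31; step (b) of the
complete proof of R2-non-uniform recorded in the evidence memo `R2-NONUNIFORM-leafhand-3-g2.md` v4 on the crux item).  Class-free real
analysis, Mathlib only.  **No stub and no summit is closed by this file; Navier–Stokes regularity is NOT proved here (rung 0).**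

Setting: `g : ℝ → ℝ` (= the value `w(z, X z)` of the solution along a forward characteristic) with `|g'| ≤ L`, a continuous `φ` (= the
derivative `κ'` of the characteristic speed) with `φ(g z) ≥ 0`, an antiderivative `A` of `φ ∘ g` whose increments behind `z₀` are bounded
(`A z₀ − A z ≤ B` for `z ≤ z₀` — the backward budget of `…ZShockPSystemBackwardBudget.pSystem_backward_budget`, p822821), and the
NON-UNIFORM genuine-nonlinearity hypothesis «`φ` is not identically zero on any nontrivial interval».

* `exists_tendsto_atBot_of_budget` — ★ `g` converges as `z → −∞`.  If `liminf g < limsup g`, some band `[v−δ, v+δ]` strictly between them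
  carries `φ ≥ c > 0` (a value `v` with `φ v ≠ 0` exists in the gap by hypothesis, is attained by `g`, so `φ v > 0`); every late crossing of
  the band takes height `≥ 2δ/L` and so costs budget `≥ 2δc/L`, while the monotone bounded-below function `A` has arbitrarily small total
  increment far enough back — contradiction.
* `apply_eq_zero_of_tendsto_of_budget` — the limit `d` is DEGENERATE: `φ d = 0` (else `A' ≥ φ d/2` eventually and the budget is infinite).

[folklore]
-/

noncomputable section

namespace Summit.NavierStokesRegularity.NavierStokesRegularity.Theorems.PoloidalWindowDoorPoloidalWindowRigidityZShockBudgetConvergence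

-- the summit and its single sub-problem share the name (CONVENTIONS §1)
set_option linter.dupNamespace false

open Set Filter Topology

/-- Increment bound for a function with derivative `≥ c` on `[x, y]`: `c (y − x) ≤ F y − F x`. -/
theorem mul_sub_le_sub_of_deriv_ge {F f : ℝ → ℝ} {c x y : ℝ} (hxy : x ≤ y)
    (hF : ∀ t ∈ Icc x y, HasDerivAt F (f t) t) (hc : ∀ t ∈ Icc x y, c ≤ f t) :
    c * (y - x) ≤ F y - F x := by
  have hcont : ContinuousOn F (Icc x y) := fun t ht => (hF t ht).continuousAt.continuousWithinAt
  have hdiff : DifferentiableOn ℝ F (interior (Icc x y)) := by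
    intro t ht
    rw [interior_Icc] at ht
    exact (hF t (Ioo_subset_Icc_self ht)).differentiableAt.differentiableWithinAt
  have hge : ∀ t ∈ interior (Icc x y), c ≤ deriv F t := by
    intro t ht
    rw [interior_Icc] at ht
    rw [(hF t (Ioo_subset_Icc_self ht)).deriv]
    exact hc t (Ioo_subset_Icc_self ht)
  exact (convex_Icc x y).mul_sub_le_image_sub_of_le_deriv hcont hdiff hge x (left_mem_Icc.2 hxy) y
    (right_mem_Icc.2 hxy) hxy

/-- Increment bound for a function with derivative `≤ L` on `[x, y]`: `F y − F x ≤ L (y − x)`. -/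
theorem sub_le_mul_sub_of_deriv_le {F f : ℝ → ℝ} {L x y : ℝ} (hxy : x ≤ y)
    (hF : ∀ t ∈ Icc x y, HasDerivAt F (f t) t) (hL : ∀ t ∈ Icc x y, f t ≤ L) :
    F y - F x ≤ L * (y - x) := by
  have h := mul_sub_le_sub_of_deriv_ge (F := fun t => -F t) (f := fun t => -f t) (c := -L) hxy
    (fun t ht => (hF t ht).neg) (fun t ht => by linarith [hL t ht])
  linarith

/-- **★ Convergence under a finite genuine-nonlinearity budget.**  Let `g : ℝ → ℝ` have `|g'| ≤ L`, let `φ` be continuous with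
`φ (g z) ≥ 0` for all `z` and not identically zero on any nontrivial interval, and let `A` be an antiderivative of `φ ∘ g` with
`A z₀ − A z ≤ B` for all `z ≤ z₀`; assume `m ≤ g ≤ M`.  Then `g` has a limit as `z → −∞`. [folklore] -/
theorem exists_tendsto_atBot_of_budget {g g' φ A : ℝ → ℝ} {L B z₀ m M : ℝ} (hL : 0 < L)
    (hg : ∀ z, HasDerivAt g (g' z) z) (hg' : ∀ z, |g' z| ≤ L) (hm : ∀ z, m ≤ g z) (hM : ∀ z, g z ≤ M)
    (hφc : Continuous φ) (hφ0 : ∀ z, 0 ≤ φ (g z)) (hgn : ∀ a b : ℝ, a < b → ∃ v ∈ Ioo a b, φ v ≠ 0)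
    (hA : ∀ z, HasDerivAt A (φ (g z)) z) (hB : ∀ z ≤ z₀, A z₀ - A z ≤ B) :
    ∃ d : ℝ, Tendsto g atBot (𝓝 d) := by
  have hgc : Continuous g := continuous_iff_continuousAt.2 fun z => (hg z).continuousAt
  have hbdd_le : IsBoundedUnder (· ≤ ·) atBot g := isBoundedUnder_of ⟨M, hM⟩
  have hbdd_ge : IsBoundedUnder (· ≥ ·) atBot g := isBoundedUnder_of ⟨m, hm⟩
  set a₀ := liminf g atBot with ha₀
  set b₀ := limsup g atBot with hb₀
  have hab : a₀ ≤ b₀ := liminf_le_limsup hbdd_le hbdd_ge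
  rcases eq_or_lt_of_le hab with heq | hlt
  · exact ⟨a₀, tendsto_of_liminf_eq_limsup rfl heq.symm hbdd_le hbdd_ge⟩
  exfalso
  -- a value `v` strictly between with `φ v ≠ 0`, and a band around it
  obtain ⟨v, hv, hφv⟩ := hgn a₀ b₀ hlt
  set a' := (a₀ + v) / 2 with ha'
  set b' := (v + b₀) / 2 with hb'
  have ha'lt : a₀ < a' := by rw [ha']; linarith [hv.1]
  have ha'v : a' < v := by rw [ha']; linarith [hv.1]
  have hvb' : v < b' := by rw [hb']; linarith [hv.2]
  have hb'lt : b' < b₀ := by rw [hb']; linarith [hv.2]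
  -- `g` is frequently below `a'` and frequently above `b'` near `-∞`
  have hfa : ∃ᶠ z in atBot, g z < a' := frequently_lt_of_liminf_lt hbdd_le.isCoboundedUnder_ge (by rw [← ha₀]; exact ha'lt)
  have hfb : ∃ᶠ z in atBot, b' < g z := frequently_lt_of_lt_limsup hbdd_ge.isCoboundedUnder_le (by rw [← hb₀]; exact hb'lt)
  rw [frequently_atBot] at hfa hfb
  -- `v` is attained, hence `φ v > 0`
  have hφvpos : 0 < φ v := by
    obtain ⟨z₂, -, hz₂⟩ := hfb 0
    obtain ⟨z₁, hz₁, hz₁'⟩ := hfa z₂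
    have hIVT := intermediate_value_Icc hz₁ hgc.continuousOn
    have hvmem : v ∈ Icc (g z₁) (g z₂) := ⟨by linarith, by linarith⟩
    obtain ⟨q, -, hq⟩ := hIVT hvmem
    have h0 := hφ0 q
    rw [hq] at h0
    exact lt_of_le_of_ne h0 (Ne.symm hφv)
  -- continuity of `φ` at `v`: a band `[v - δ, v + δ] ⊆ (a', b')` on which `φ ≥ φ v / 2`
  obtain ⟨δ, hδ, hband⟩ : ∃ δ > 0, (∀ u, |u - v| ≤ δ → φ v / 2 ≤ φ u) ∧ a' < v - δ ∧ v + δ < b' := by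
    have hcont := Metric.continuousAt_iff.1 (hφc.continuousAt (x := v)) (φ v / 2) (by linarith)
    obtain ⟨δ₁, hδ₁, hδ₁'⟩ := hcont
    set δ := min (δ₁ / 2) (min ((v - a') / 2) ((b' - v) / 2)) with hδdef
    have hδpos : 0 < δ := by
      rw [hδdef]; exact lt_min (by linarith) (lt_min (by linarith) (by linarith))
    have hδ1 : δ ≤ δ₁ / 2 := min_le_left _ _
    have hδ2 : δ ≤ (v - a') / 2 := (min_le_right _ _).trans (min_le_left _ _)
    have hδ3 : δ ≤ (b' - v) / 2 := (min_le_right _ _).trans (min_le_right _ _)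
    refine ⟨δ, hδpos, fun u hu => ?_, by linarith, by linarith⟩
    have hdist : dist u v < δ₁ := by
      rw [Real.dist_eq]; linarith
    have h := hδ₁' hdist
    rw [Real.dist_eq] at h
    linarith [abs_lt.1 h]
  obtain ⟨hband, hva, hvb⟩ := hband
  set c := φ v / 2 with hcdef
  have hc : 0 < c := by rw [hcdef]; linarith
  -- the budget: `A` is monotone and bounded below on `(-∞, z₀]`; far back its increments are `< θ := c (2δ/L)`
  set θ := c * (2 * δ / L) with hθdef
  have hθ : 0 < θ := by positivity
  have hAmono : Monotone A := monotone_of_deriv_nonneg (fun z => (hA z).differentiableAt) fun z => by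
    rw [(hA z).deriv]; exact hφ0 z
  set S : Set ℝ := A '' Iic z₀ with hSdef
  have hSne : S.Nonempty := ⟨A z₀, Set.mem_image_of_mem A (Set.self_mem_Iic : z₀ ∈ Iic z₀)⟩
  have hSbdd : BddBelow S := ⟨A z₀ - B, by rintro _ ⟨z, hz, rfl⟩; linarith [hB z hz]⟩
  set I := sInf S with hIdef
  have hIle : ∀ z ≤ z₀, I ≤ A z := fun z hz => csInf_le hSbdd ⟨z, hz, rfl⟩
  obtain ⟨_, ⟨Z₁, hZ₁, rfl⟩, hZ₁lt⟩ := exists_lt_of_csInf_lt hSne (show I < I + θ by linarith)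
  have hsmall : ∀ t₁ t₂, t₁ ≤ t₂ → t₂ ≤ Z₁ → A t₂ - A t₁ < θ := by
    intro t₁ t₂ h12 h2
    have h1 : I ≤ A t₁ := hIle t₁ (h12.trans (h2.trans hZ₁))
    have h2' : A t₂ ≤ A Z₁ := hAmono h2
    linarith
  -- a late crossing: `z'' ≤ Z₁` with `g z'' > b'`, `z' ≤ z''` with `g z' < a'`
  obtain ⟨z'', hz''Z, hgz''⟩ := hfb Z₁
  obtain ⟨z', hz'le, hgz'⟩ := hfa z''
  have hz'lt : z' < z'' := lt_of_le_of_ne hz'le (by rintro rfl; linarith)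
  -- first hitting time of `v + δ` after `z'`
  set T₂ : Set ℝ := Icc z' z'' ∩ g ⁻¹' Ici (v + δ) with hT₂
  have hT₂cl : IsClosed T₂ := hgc.continuousOn.preimage_isClosed_of_isClosed isClosed_Icc isClosed_Ici
  have hT₂ne : T₂.Nonempty := ⟨z'', ⟨hz'le, le_rfl⟩, show v + δ ≤ g z'' from by linarith⟩
  have hT₂bdd : BddBelow T₂ := ⟨z', fun t ht => ht.1.1⟩
  set t₂ := sInf T₂ with ht₂
  have ht₂mem : t₂ ∈ T₂ := hT₂cl.csInf_mem hT₂ne hT₂bdd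
  have hgt₂ge : v + δ ≤ g t₂ := ht₂mem.2
  have hz't₂ : z' < t₂ := by
    rcases eq_or_lt_of_le ht₂mem.1.1 with h | h
    · exfalso; rw [← h] at hgt₂ge; linarith
    · exact h
  have hbelow₂ : ∀ t ∈ Ico z' t₂, g t < v + δ := by
    intro t ht
    by_contra hge
    have htT : t ∈ T₂ := ⟨⟨ht.1, ht.2.le.trans ht₂mem.1.2⟩, not_lt.1 hge⟩
    exact absurd (csInf_le hT₂bdd htT) (not_le.2 ht.2)
  have hgt₂ : g t₂ = v + δ := by
    refine le_antisymm ?_ hgt₂ge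
    -- `t₂` is in the closure of `[z', t₂)` where `g < v + δ`
    have hcl : t₂ ∈ closure (Ico z' t₂) := by
      rw [closure_Ico hz't₂.ne]; exact right_mem_Icc.2 hz't₂.le
    have hsub : Ico z' t₂ ⊆ g ⁻¹' Iic (v + δ) := fun t ht => (hbelow₂ t ht).le
    have hclosed : IsClosed (g ⁻¹' Iic (v + δ)) := isClosed_Iic.preimage hgc
    exact closure_minimal hsub hclosed hcl
  -- last time `≤ v - δ` before `t₂`
  set T₁ : Set ℝ := Icc z' t₂ ∩ g ⁻¹' Iic (v - δ) with hT₁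
  have hT₁cl : IsClosed T₁ := hgc.continuousOn.preimage_isClosed_of_isClosed isClosed_Icc isClosed_Iic
  have hT₁ne : T₁.Nonempty := ⟨z', ⟨le_rfl, hz't₂.le⟩, show g z' ≤ v - δ from by linarith⟩
  have hT₁bdd : BddAbove T₁ := ⟨t₂, fun t ht => ht.1.2⟩
  set t₁ := sSup T₁ with ht₁
  have ht₁mem : t₁ ∈ T₁ := hT₁cl.csSup_mem hT₁ne hT₁bdd
  have hgt₁le : g t₁ ≤ v - δ := ht₁mem.2
  have ht₁t₂ : t₁ < t₂ := by
    rcases eq_or_lt_of_le ht₁mem.1.2 with h | h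
    · exfalso; rw [h] at hgt₁le; linarith
    · exact h
  have habove₁ : ∀ t ∈ Ioc t₁ t₂, v - δ < g t := by
    intro t ht
    by_contra hle
    have htT : t ∈ T₁ := ⟨⟨ht₁mem.1.1.trans ht.1.le, ht.2⟩, not_lt.1 hle⟩
    exact absurd (le_csSup hT₁bdd htT) (not_le.2 ht.1)
  have hgt₁ : g t₁ = v - δ := by
    refine le_antisymm hgt₁le ?_
    have hcl : t₁ ∈ closure (Ioc t₁ t₂) := by
      rw [closure_Ioc ht₁t₂.ne]; exact left_mem_Icc.2 ht₁t₂.le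
    have hsub : Ioc t₁ t₂ ⊆ g ⁻¹' Ici (v - δ) := fun t ht => (habove₁ t ht).le
    have hclosed : IsClosed (g ⁻¹' Ici (v - δ)) := isClosed_Ici.preimage hgc
    exact closure_minimal hsub hclosed hcl
  -- on `[t₁, t₂]` the values stay in the band, so `A' = φ ∘ g ≥ c` there
  have hbandI : ∀ t ∈ Icc t₁ t₂, |g t - v| ≤ δ := by
    intro t ht
    rw [abs_le]
    rcases eq_or_lt_of_le ht.1 with h | h
    · rw [← h, hgt₁]; constructor <;> linarith
    rcases eq_or_lt_of_le ht.2 with h' | h'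
    · rw [h', hgt₂]; constructor <;> linarith
    have h1 := habove₁ t ⟨h, h'.le⟩
    have h2 := hbelow₂ t ⟨ht₁mem.1.1.trans ht.1, h'⟩
    constructor <;> linarith
  have hAincr : c * (t₂ - t₁) ≤ A t₂ - A t₁ :=
    mul_sub_le_sub_of_deriv_ge ht₁t₂.le (fun t _ => hA t) fun t ht => hband _ (hbandI t ht)
  have hgincr : g t₂ - g t₁ ≤ L * (t₂ - t₁) :=
    sub_le_mul_sub_of_deriv_le ht₁t₂.le (fun t _ => hg t) fun t _ => (le_abs_self _).trans (hg' t)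
  have hlen : 2 * δ ≤ L * (t₂ - t₁) := by rw [hgt₂, hgt₁] at hgincr; linarith
  have hcost : θ ≤ A t₂ - A t₁ := by
    rw [hθdef]
    have : c * (2 * δ / L) ≤ c * (t₂ - t₁) := by
      apply mul_le_mul_of_nonneg_left _ hc.le
      rw [div_le_iff₀ hL]; linarith
    exact this.trans hAincr
  have hcheap : A t₂ - A t₁ < θ := hsmall t₁ t₂ ht₁t₂.le (ht₂mem.1.2.trans hz''Z)
  linarith

/-- **The limit is a degenerate value.**  In the setting of `exists_tendsto_atBot_of_budget` (only the budget, the sign of `φ ∘ g` and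
continuity of `φ` are used), if `g → d` as `z → −∞` then `φ d = 0`: otherwise `A' = φ(g z) ≥ φ d / 2 > 0` for all `z ≤ Z₂` and
`A z₀ − A z ≥ (φ d/2)(Z₂ − z)` is unbounded. [folklore] -/
theorem apply_eq_zero_of_tendsto_of_budget {g φ A : ℝ → ℝ} {B z₀ d : ℝ}
    (hφc : Continuous φ) (hφ0 : ∀ z, 0 ≤ φ (g z))
    (hA : ∀ z, HasDerivAt A (φ (g z)) z) (hB : ∀ z ≤ z₀, A z₀ - A z ≤ B) (hd : Tendsto g atBot (𝓝 d)) :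
    φ d = 0 := by
  have hφd : Tendsto (fun z => φ (g z)) atBot (𝓝 (φ d)) := (hφc.tendsto d).comp hd
  have hφd0 : 0 ≤ φ d := ge_of_tendsto' hφd fun z => hφ0 z
  by_contra hne
  have hpos : 0 < φ d := lt_of_le_of_ne hφd0 (Ne.symm hne)
  have hev : ∀ᶠ z in atBot, φ d / 2 ≤ φ (g z) :=
    (hφd.eventually (eventually_ge_nhds (show φ d / 2 < φ d by linarith))).mono fun z hz => hz
  rw [eventually_atBot] at hev
  obtain ⟨Z₂, hZ₂⟩ := hev
  set Z := min Z₂ z₀ with hZ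
  have hZz₀ : Z ≤ z₀ := min_le_right _ _
  have hZZ₂ : Z ≤ Z₂ := min_le_left _ _
  have hAmono : Monotone A := monotone_of_deriv_nonneg (fun z => (hA z).differentiableAt) fun z => by
    rw [(hA z).deriv]; exact hφ0 z
  -- take `z₁ = Z - 2(B+1)/φ d`
  set z₁ := Z - 2 * (B + 1) / φ d with hz₁
  have hz₁Z : z₁ ≤ Z := by
    have hB0 : 0 ≤ B := by have := hB z₀ le_rfl; linarith
    have : 0 ≤ 2 * (B + 1) / φ d := by positivity
    rw [hz₁]; linarith
  have hincr : φ d / 2 * (Z - z₁) ≤ A Z - A z₁ :=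
    mul_sub_le_sub_of_deriv_ge hz₁Z (fun t _ => hA t) fun t ht => hZ₂ t (ht.2.trans hZZ₂)
  have hval : φ d / 2 * (Z - z₁) = B + 1 := by
    rw [hz₁]; field_simp; ring
  have h1 : A z₀ - A z₁ ≤ B := hB z₁ (hz₁Z.trans hZz₀)
  have h2 : A Z ≤ A z₀ := hAmono hZz₀
  linarith

end Summit.NavierStokesRegularity.NavierStokesRegularity.Theorems.PoloidalWindowDoorPoloidalWindowRigidityZShockBudgetConvergence

end
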